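import Summits.QuantumAdvantage.QuantumAdvantage.Theorems.MobiusLadderLiouvilleOrthogonalTC0StubConstSubst3
import HarnessLib

/-!
# Crux `MobiusLadder.LiouvilleOrthogonalTC0` (stmt-QuantumAdvantage-1393), line `Sketch` (v12):
# stub `stub_substStrong` — constant substitution for the genuine majority gates, with prefix agreement

Registered stub `stub_substStrong` (lead `prover-line-stmt-QuantumAdvantage-1393-c6-0`, skeleton v12,
rung "`tcBasis` circuits with `O(1)` genuine majority gates anywhere"). This is the wire-level surgery
`ConstSubst3.exists_subst3` (`…StubConstSubst3.lean`: every majority gate `MAJₖ`, `k ≥ 3`, of a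
well-formed `tcBasis` program `gs` is replaced, at the same position, by the constant gate guessed by
`v`; every other gate is kept and is a gate of `acBasis`) with a STRONGER value clause, kept for every
prefix: if the guesses `v i` are right for the genuine majority gates of index `i < t`, then the value
lists of the new and the old program agree at every index `< t` (the old clause is the case
`t = |gs|`). The lead needs this to read the `i`-th majority gate on the wires of the substituted
circuit when only the guesses below it are known to be right.

* `StubSubstStrong.getD_vals_step` — the value clause of the inductive step `gs ↦ gs ++ [g]`,
  `gs' ↦ gs' ++ [g']`, for any new gate `g'` whose value on the (equal) prefix values is that of `g`
  whenever the guess for `g` is right (if `g` is a genuine majority gate);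
* `stub_substStrong` — the registered stub, verbatim (reverse induction on the program, as in
  `ConstSubst3.exists_subst3`, whose `WF` / `acBasis` / length / `wdepths` bookkeeping is reused).
-/

set_option linter.dupNamespace false -- D-0017: single-problem summit ⇒ `QuantumAdvantage.QuantumAdvantage` by design

noncomputable section

namespace Summit.QuantumAdvantage.QuantumAdvantage.Theorems.LiouvilleOrthogonalTC0

open Finset
open Literature.Computability.Complexity
open Literature.Computability.Complexity.GateList

namespace StubSubstStrong

/-- **The value clause of the inductive step.** Let `gs'` be a program of the length of `gs` whose
values agree with those of `gs` below `t` whenever the guesses `v` are right for the genuine majority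
gates of `gs` below `t` (all `t`), and let `g'` be a gate whose value on top of `vals gs' x = vals gs x`
is the value of `g` on top of `vals gs x`, provided the guess `v |gs|` is the value of `g` in case `g`
is a genuine majority gate. Then `gs' ++ [g']` and `gs ++ [g]` agree below `t` whenever the guesses are
right for the genuine majority gates of `gs ++ [g]` below `t`. -/
theorem getD_vals_step {n : ℕ} {v : ℕ → Bool} {gs gs' : List (Gate (Fin n))} {g g' : Gate (Fin n)}
    (hlen : gs'.length = gs.length)
    (hval : ∀ (x : Fin n → Bool) (t : ℕ),
      (∀ (i : ℕ) (hi : i < gs.length), i < t → (∃ k, 3 ≤ k ∧ (gs[i]).fn = GateFn.maj k) →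
        v i = (vals gs x).getD i false) →
      ∀ i, i < t → (vals gs' x).getD i false = (vals gs x).getD i false)
    (hg' : ∀ x : Fin n → Bool, vals gs' x = vals gs x →
      ((∃ k, 3 ≤ k ∧ g.fn = GateFn.maj k) →
        v gs.length = g.op (fun a => wireOf x (vals gs x) (g.args a))) →
      g'.op (fun a => wireOf x (vals gs' x) (g'.args a)) = g.op (fun a => wireOf x (vals gs x) (g.args a)))
    (x : Fin n → Bool) (t : ℕ)
    (H : ∀ (i : ℕ) (hi : i < (gs ++ [g]).length), i < t →
      (∃ k, 3 ≤ k ∧ ((gs ++ [g])[i]).fn = GateFn.maj k) → v i = (vals (gs ++ [g]) x).getD i false)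
    (i : ℕ) (hit : i < t) :
    (vals (gs' ++ [g']) x).getD i false = (vals (gs ++ [g]) x).getD i false := by
  -- the hypothesis on the guesses, restricted to the prefix `gs`
  have hres : ∀ (j : ℕ) (hj : j < gs.length), j < t → (∃ k, 3 ≤ k ∧ (gs[j]).fn = GateFn.maj k) →
      v j = (vals gs x).getD j false := by
    intro j hj hjt hmaj
    have hj' : j < (gs ++ [g]).length := by simp; omega
    have h1 := H j hj' hjt (by rw [List.getElem_append_left hj]; exact hmaj)
    rw [h1, vals_append_singleton, List.getD_append _ _ _ _ (by simpa using hj)]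
  rcases lt_trichotomy i gs.length with hlt | rfl | hgt
  · -- an entry of the prefixes: the induction hypothesis
    rw [vals_append_singleton, vals_append_singleton,
      List.getD_append _ _ _ _ (by simpa [hlen] using hlt),
      List.getD_append _ _ _ _ (by simpa using hlt)]
    exact hval x t hres i hit
  · -- the new gate: all the guesses for the prefix are right, so the prefix values are equal lists
    have heq : vals gs' x = vals gs x := by
      refine List.ext_getElem (by simp [hlen]) fun j h₁ h₂ => ?_
      have hj : j < gs.length := by simpa using h₂
      have h := hval x t hres j (hj.trans hit)
      rwa [List.getD_eq_getElem _ _ h₁, List.getD_eq_getElem _ _ h₂] at h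
    have hnew : (vals (gs ++ [g]) x).getD gs.length false =
        g.op (fun a => wireOf x (vals gs x) (g.args a)) :=
      getD_vals_append_singleton gs g x
    have hnew' : (vals (gs' ++ [g']) x).getD gs.length false =
        g'.op (fun a => wireOf x (vals gs' x) (g'.args a)) := by
      rw [← hlen]
      exact getD_vals_append_singleton gs' g' x
    rw [hnew, hnew']
    refine hg' x heq fun hmaj => ?_
    rw [← hnew]
    exact H gs.length (by simp) hit (by rw [List.getElem_concat_length rfl]; exact hmaj)
  · -- out of range on both sides
    rw [List.getD_eq_default _ _ (by simp [hlen]; omega), List.getD_eq_default _ _ (by simp; omega)]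

end StubSubstStrong

/-- **Registered stub `stub_substStrong` (wave 5, v12): constant substitution for the genuine majority
gates, wire level with prefix agreement.** For a well-formed program `gs` over `tcBasis` on the inputs
`Fin n` and a guess `v`, there is a well-formed program `gs'` over `acBasis` of the same length (gate
`i` kept unless it is a majority gate of fan-in `≥ 3`, which is replaced by the constant gate `v i`)
whose `acWeight`-depths are pointwise at most those of `gs`, and such that for every input `x` and
every `t`: if `v i` is the value of every genuine majority gate `i < t` of `gs` at `x`, then the gate
values of `gs'` and `gs` at `x` agree at every index `< t` (the induction of
`ConstSubst3.exists_subst3` with the invariant kept for every prefix). -/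
theorem stub_substStrong {n : ℕ} (v : ℕ → Bool) (gs : List (Gate (Fin n))) (hwf : GateList.WF gs)
    (hB : ∀ g ∈ gs, g.fn ∈ tcBasis) :
    ∃ gs' : List (Gate (Fin n)), GateList.WF gs' ∧ (∀ g ∈ gs', g.fn ∈ acBasis) ∧
      gs'.length = gs.length ∧
      (∀ i, (GateList.wdepths acWeight gs').getD i 0 ≤ (GateList.wdepths acWeight gs).getD i 0) ∧
      ∀ (x : Fin n → Bool) (t : ℕ),
        (∀ (i : ℕ) (hi : i < gs.length), i < t → (∃ k, 3 ≤ k ∧ (gs[i]).fn = GateFn.maj k) →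
          v i = (GateList.vals gs x).getD i false) →
        ∀ i, i < t → (GateList.vals gs' x).getD i false = (GateList.vals gs x).getD i false := by
  induction gs using List.reverseRecOn with
  | nil => exact ⟨[], WF.nil, by simp, rfl, fun j => le_rfl, fun x t _ i _ => rfl⟩
  | append_singleton gs g ih =>
    obtain ⟨gs', hwf', hB', hlen, hdep, hval⟩ :=
      ih hwf.of_append_left fun g' hg' => hB g' (List.mem_append_left _ hg')
    have hgB : g.fn ∈ tcBasis := hB g (by simp)
    have hok : GateOK gs.length g := hwf.getLast
    have hlen' : (wdepths acWeight gs').length = (wdepths acWeight gs).length := by simp [hlen]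
    by_cases hmaj : ∃ k, 3 ≤ k ∧ g.fn = GateFn.maj k
    · -- a genuine majority gate: replaced by the guessed constant `v |gs|`
      refine ⟨gs' ++ [GateList.constGate (Fin n) (v gs.length)],
        hwf'.append_singleton (gateOK_constGate _ _), ?_, by simp [hlen], ?_, ?_⟩
      · intro g' hg'
        rw [List.mem_append, List.mem_singleton] at hg'
        rcases hg' with hg' | rfl
        · exact hB' g' hg'
        · rw [GateList.constGate_fn]
          exact const_mem_acBasis _
      · rw [wdepths_append_singleton, wdepths_append_singleton]
        refine ConstSubst.getD_append_singleton_le hlen' hdep ?_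
        obtain ⟨k, -, hk⟩ := hmaj
        rw [GateList.constGate_fn, acWeight_const, hk, acWeight_maj]
        exact Nat.add_le_add_left ((Finset.sup_le fun a _ => a.elim0).trans (Nat.zero_le _)) 1
      · exact StubSubstStrong.getD_vals_step hlen hval fun x _ hm => hm hmaj
    · -- any other gate is a gate of `acBasis`: kept, at the same position
      have hgA : g.fn ∈ acBasis := ConstSubst3.mem_acBasis_of_not_bigMaj hgB hmaj
      refine ⟨gs' ++ [g], hwf'.append_singleton (hok.mono hlen.ge), ?_, by simp [hlen], ?_, ?_⟩
      · intro g' hg'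
        rw [List.mem_append, List.mem_singleton] at hg'
        rcases hg' with hg' | rfl
        · exact hB' g' hg'
        · exact hgA
      · rw [wdepths_append_singleton, wdepths_append_singleton]
        refine ConstSubst.getD_append_singleton_le hlen' hdep ?_
        refine Nat.add_le_add_left (Finset.sup_mono_fun fun a _ => ?_) _
        cases g.args a with
        | inl i => rw [wireDepthOf_inl, wireDepthOf_inl]
        | inr m => rw [wireDepthOf_inr, wireDepthOf_inr]; exact hdep m
      · exact StubSubstStrong.getD_vals_step hlen hval fun x heq _ => by rw [heq]

end Summit.QuantumAdvantage.QuantumAdvantage.Theorems.LiouvilleOrthogonalTC0
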